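import Literature.MathematicalPhysics.QuantumFieldTheory.Balaban1983to89.B13InverseLettersOnCoerciveBallLocated

/-!
# `Balaban1983to89.B13CoerciveAlongPencilLocated` — T. Bałaban, *Propagators for lattice gauge theories in a background field*, Commun. Math. Phys. **99** (1985)
# 389–434 [Balaban1985BackgroundPropagators], (3.10) p. 392, (3.25)–(3.27) pp. 394–395, (3.34)–(3.35) p. 396, (3.46)–(3.47) p. 398, Thm 3.3 p. 399, Thm 3.4 and (3.50)
# p. 400 («The extended operators satisfy all the inequalities of Theorems 3.1–3.3 correspondingly … describing these analytic extensions as small perturbations of the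
# operators depending on U only»), (3.62)–(3.64) p. 402, (3.84) p. 407, Thm 3.10 (3.107)–(3.108) p. 416, Thm 3.11 p. 416; [Balaban1984PropagatorsII] p. 226, (2.54)
# p. 232, Lemma 2.1 (2.61) p. 234; [Balaban1988RG2Cluster] (2.5)–(2.7) pp. 12–13, p. 15: ★★★ THE LANE's MODULE 83 §4 (THEOREM 3.11's CLAUSE IS OPEN ALONG pv27's PENCIL
# WITH A LOCATED RADIUS) AT THE READINGS OF RECORD — `(M_N(ℂ), matrix units, bondReadingY ∕ fineReadingY, m_F = (d+1)·N², G ≤ U(N))` — and its twins with Δ_a's pencil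
# letters DISCHARGED from the R-station's output `hR` (this seat's `B13InverseLettersOnCoerciveBallLocated.rawEntryLetters_toMatrix_deltaAY_parBY_prodCfg_of_pencil_located`).

THE DISPLAY.  The lane owner's module 83 (`B13CoerciveAlongPencil` §4) reads: Δ_a's pencil letters `hA : RawEntryLetters (A′ ↦ toMatrix (Δ_a(e^{iηA′}U₀))) loc R ρ B_Δ`, a
fibre bound `m_F` of `loc`, the centre's coercivity `m·⟨Ψ,Ψ⟩₁ ≤ ⟨Ψ, Δ_a(U₀)Ψ⟩₁`, radii `0 ≤ R′ ≤ R` ⟹ `(m − 2(B_Δ(m_F c₀(1,ρ)^ν))R′∕R)`-coercivity of `Δ_a(e^{iηA′}U₀)`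
for every `‖A′‖ < R′`, hence Theorem 3.11's clause `PosDefTr 1` there when `2(B_Δ(m_F c₀(1,ρ)^ν))R′ < mR` (also on the gauge orbit of the ball, and with the centre
supplied from print's two statements by module 82).  THIS FILE writes the location numerals in — `loc := bondReadingY ∘ fst`, `ν := d+1`, `m_F := (d+1)·N²`
(`card_fibre_bondReadingY_matrixUnits`) — (§1), and then DISCHARGES `hA` at `parB := parBY` from the R-station's output `hR` on the site sector at the fine reading with
the ONE dominating constant `B′` (`hBΔ`, the same located inequality as this seat's `B13GreenStationCoerciveLocated` §1 ∕ `B13InverseLettersOnCoerciveBallLocated` §2) (§2):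
the clause's ball has a radius that is a NUMBER in `(m, B′, d, N, ρ, Rd)`.

[folklore] positional applications of cited tree theorems (every theorem ONE application; §2's twins one `have` + `rawEntryLetters_mono` + one application); kernel-checked;
THEOREMS ONLY (no `def`, no `structure`, no instance, no notation; `open scoped Matrix.Norms.L2Operator` = the record's norm); NOTHING of NODE 00's ∕ pv27's ∕ the lane's ∕
dag-n10-w2's ∕ dag-n10-w5's ∕ dag-n10-w6's ∕ n06-j's files is modified; nothing here is a claim about the Yang–Mills mass gap; no node is discharged; count-neutral.

WHY THIS FILE (cell `pub-ymgap`, HUMAN RULING D-0062 ∕ D-0149, Track A node N10 = [B13]; WIDTH SEAT `pub-ymgap-dag-n10-w4` g6, CLAIM-3 (R455 (A)); the sibling of the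
lane owner's census v21 item 3 «located editions at the readings of record of 82 §3 ∕ 84 §2 (w4)» for module 83, whose §4 is the row-17 face of the same road: the
N06 certificate's row 17 displays Theorem 3.11's clause per member and the director's standing A6 rule asks for NAMED inhabitant classes — here the OPEN located ball
around any coercive background, its radius read off the R-station's output).  WHICH reading the N10 term of record uses is NODE 00's ∕ def-T's word — NOT claimed here.

WHAT THIS FILE PROVES (all `theorem`s).
* §1 (Δ_a's pencil letters `hA` DISPLAYED at the bond reading; ANY `N`) ★ `trIP_deltaAY_prodCfg_ge_of_coer_centre_located` · ★ `posDefTr_deltaAY_prodCfg_of_coer_centre_located`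
  · ★ `posDefTr_deltaAY_parSymY_gaugeY_prodCfg_of_coer_centre_located` · ★ `posDefTr_deltaAY_parSymY_prodCfg_of_posDefTr_of_GAY_formBound_located` — module 83 §4's four
  theorems with `hfib` discharged and `(loc, ν, m_F) := (bondReadingY ∘ fst, d+1, (d+1)N²)`.
* §2 (`hA` DISCHARGED from `hR`; `N ≥ 1`, `G ≤ U(N)`, `G`-valued `U₀`, `parB := parBY`) ★★ `trIP_deltaAY_parBY_prodCfg_ge_of_pencil_of_coer_centre_located` (the
  `(m − 2(B′c_V)R′∕Rd)`-coercivity of `Δ_a(e^{iηA′}U₀)` on `‖A′‖ < R′ ≤ Rd` from `hR`, `hBΔ`, `m`) · ★★ `posDefTr_deltaAY_parBY_prodCfg_of_pencil_of_coer_centre_located`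
  (row 17's clause on the located ball `2(B′c_V)R′ < mRd`) · ★★ `posDefTr_deltaAY_parSymY_gaugeY_prodCfg_of_pencil_of_coer_centre_located` (on its gauge orbit) · ★★
  `posDefTr_deltaAY_parSymY_prodCfg_of_pencil_of_posDefTr_of_GAY_formBound_located` (centre from Theorem 3.11's clause + Theorem 3.3's (3.46)–(3.47), `m = B⁻¹`).
HONEST FRAMING: located instances; finite-lattice constants, NOT optimised, NOT print's `O(1)`; the analytic inputs — the R-station's output `hR` (Theorems 3.1 ∕ 3.2 through
dag-n10-w2's ∕ dag-n10-w5's stations), Δ_a's coercivity `hco`, resp. Theorem 3.11's clause `hpd` and Theorem 3.3's (3.46)–(3.47) form bound `hGB` for `G(U₀)` AT THE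
CENTRE — are DISPLAYED, not proved (N06's ∕ the junction's); the balls are in the CHART around `U₀`, NOT print's class (3.35); the clause is NOT proved for any member of
(3.35) here; nothing of Bałaban's asserted; N06 ∕ N10 NOT discharged; K1⁹ stmt-QuantumFields-27364 OPEN, no registered stub proved; counts unmoved (typed 28∕28 · discharged
5∕27); 0 `def`, 0 `sorry`, standard axioms; one finite 𝕋⁴ programme at fixed ε, Bałaban AS PRINTED — R4 closes the conditional finite-𝕋⁴ rung `BalabanLadder.UV` only; the
YM mass gap (Clay) is NOT proved by any of this; nothing continuum ∕ ℝ⁴ ∕ OS.  Filed `--kind proof --supports stmt-QuantumFields-27364`, Literature lane.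

References: T. Bałaban, CMP 99 (1985) 389–434 [Balaban1985BackgroundPropagators] (3.10) p.392, (3.25)–(3.27) pp.394–395, (3.34)–(3.35) p.396, (3.46)–(3.47) p.398, Thm 3.3
p.399, Thm 3.4 and (3.50) p.400, (3.62)–(3.64) p.402, (3.84) p.407, Thm 3.10 (3.107)–(3.108) pp.415–416, Thm 3.11 p.416; CMP 96 (1984) 223–250 [Balaban1984PropagatorsII]
p.226, (2.54) p.232, Lemma 2.1 (2.61) p.234; CMP 116 (1988) 1–22 [Balaban1988RG2Cluster] (2.5)–(2.7) pp.12–13, p.15.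
-/

noncomputable section

namespace Literature.MathematicalPhysics.QuantumFieldTheory.Balaban1983to89.B13CoerciveAlongPencilLocated

open Metric Finset Module
open scoped Matrix Matrix.Norms.L2Operator
open Literature.MathematicalPhysics.QuantumFieldTheory.Balaban1983to89
open Literature.MathematicalPhysics.QuantumFieldTheory.Balaban1983to89.B9Thm37GlueTorus (tdist1)
open Literature.MathematicalPhysics.QuantumFieldTheory.Balaban1983to89.B5TorusCover (UT)
open Literature.MathematicalPhysics.QuantumFieldTheory.Balaban1983to89.B9Thm311ReadingCoords (trIP PosDefTr)
open Literature.MathematicalPhysics.QuantumFieldTheory.Balaban1983to89.B13EntrywiseWalks (RawEntryLetters)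
open Literature.MathematicalPhysics.QuantumFieldTheory.Balaban1983to89.B13EntryLetterAlgebra (rawEntryLetters_mono)
open Literature.MathematicalPhysics.QuantumFieldTheory.Balaban1983to89.B9Eq39Adjoint (prodCfg)
open Literature.MathematicalPhysics.QuantumFieldTheory.Balaban1983to89.B6GlobalChartV1 (PV)
open Literature.MathematicalPhysics.QuantumFieldTheory.Balaban1983to89.B6KLevelCensusIndexV1 (KIdx)
open Literature.MathematicalPhysics.QuantumFieldTheory.Balaban1983to89.Node00
  (SiteY FBondY CfgY SiteParY SiteOpY BondParY GaugeY gaugeY RY deltaAY GAY parBY parSymY GpY toKT)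
open Literature.MathematicalPhysics.QuantumFieldTheory.Balaban1983to89.B13CoerciveAlongPencil
  (trIP_deltaAY_prodCfg_ge_of_coer_centre posDefTr_deltaAY_prodCfg_of_coer_centre posDefTr_deltaAY_parSymY_gaugeY_prodCfg_of_coer_centre
    posDefTr_deltaAY_parSymY_prodCfg_of_posDefTr_of_GAY_formBound)
open Literature.MathematicalPhysics.QuantumFieldTheory.Balaban1983to89.B13CoerciveOfInverseFormBound (trIP_deltaAY_parSymY_ge_of_posDefTr_of_GAY_formBound)
open Literature.MathematicalPhysics.QuantumFieldTheory.Balaban1983to89.B13InverseLettersOnCoerciveBallLocated (rawEntryLetters_toMatrix_deltaAY_parBY_prodCfg_of_pencil_located)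
open Literature.MathematicalPhysics.QuantumFieldTheory.Balaban1983to89.B13SiteReadingNumerals (fineReadingY)
open Literature.MathematicalPhysics.QuantumFieldTheory.Balaban1983to89.B13BlockBondReadingNumerals (bondReadingY card_fibre_bondReadingY_matrixUnits)

variable {d ℓ : ℕ} {hd : 1 ≤ d + 1} {hL : Odd (ℓ + 1) ∧ 1 < ℓ + 1} {b₀ b₁ : ℝ}
variable (i : KIdx d ℓ hd hL b₀ b₁) {N : ℕ} {G : Subgroup (Matrix (Fin N) (Fin N) ℂ)ˣ}
variable {Nf : Fin (d + 1) → ℕ} [∀ μ, NeZero (Nf μ)]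

/-! ## §1. Module 83 §4 at the bond reading of record: `loc := bondReadingY ∘ fst`, `ν := d+1`, `m_F := (d+1)·N²` (Δ_a's pencil letters displayed) -/

section Displayed

/-- ★ **83 §4 LOCATED — COERCIVITY OF `Δ_a` ALONG THE PENCIL FROM THE CENTRE, AT THE BOND READING OF RECORD** (ANY letters `parS parB Gp`, ANY `U₀`, ANY `N`):
Δ_a's pencil letters `hA` at `bondReadingY ∘ fst` (`0 < ρ`), the centre's flat coercivity `m`, radii `0 ≤ R′ ≤ R` ⟹ for every `‖A′‖ < R′` and every `Ψ`,
`(m − 2(B_Δ((d+1)N²c₀(1,ρ)^{d+1}))R′∕R)·⟨Ψ,Ψ⟩₁ ≤ ⟨Ψ, Δ_a(e^{iηA′}U₀)Ψ⟩₁` (fibre bound `card_fibre_bondReadingY_matrixUnits`, no `hfib` displayed).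
[cite: Balaban1985BackgroundPropagators, (3.26) p.395, Thm 3.4 p.400, (3.62)–(3.64) p.402, Thm 3.10 (3.108) p.416, Thm 3.11 p.416; Balaban1988RG2Cluster, (2.5)–(2.7) pp.12–13, p.15; Balaban1984PropagatorsII, Lemma 2.1 (2.61) p.234] -/
theorem trIP_deltaAY_prodCfg_ge_of_coer_centre_located (parS : SiteParY (Matrix (Fin N) (Fin N) ℂ) i)
    (parB : BondParY (Matrix (Fin N) (Fin N) ℂ) i) (Gp : SiteOpY (Matrix (Fin N) (Fin N) ℂ) i) (U₀ : CfgY (Matrix (Fin N) (Fin N) ℂ) i)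
    (hNf : ∀ μ, (toKT i).NB μ = Nf μ) (η : ℝ) {R R' ρ BΔ m : ℝ}
    (hA : RawEntryLetters (fun a : Fin (d + 1) → Site (PV d ℓ i.m i.K hd hL) 0 → Matrix (Fin N) (Fin N) ℂ =>
      LinearMap.toMatrix
        ((Pi.basis fun _ : FBondY i => Matrix.stdBasis ℂ (Fin N) (Fin N)).reindex (Equiv.sigmaEquivProd (FBondY i) (Fin N × Fin N)))
        ((Pi.basis fun _ : FBondY i => Matrix.stdBasis ℂ (Fin N) (Fin N)).reindex (Equiv.sigmaEquivProd (FBondY i) (Fin N × Fin N)))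
        (deltaAY i parS parB Gp (prodCfg U₀ η a)))
      (fun p : FBondY i × (Fin N × Fin N) => bondReadingY i hNf p.1) R ρ BΔ)
    (hρ : 0 < ρ)
    (hco : ∀ Ψ : FBondY i → Matrix (Fin N) (Fin N) ℂ, m * trIP (fun _ => (1 : ℝ)) Ψ Ψ ≤ trIP (fun _ => (1 : ℝ)) Ψ (deltaAY i parS parB Gp U₀ Ψ))
    (hR' : 0 ≤ R') (hR'R : R' ≤ R) :
    ∀ a ∈ ball (0 : Fin (d + 1) → Site (PV d ℓ i.m i.K hd hL) 0 → Matrix (Fin N) (Fin N) ℂ) R', ∀ Ψ : FBondY i → Matrix (Fin N) (Fin N) ℂ,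
      (m - 2 * (BΔ * ((((d + 1) * (N * N) : ℕ) : ℝ) * B6.c0 1 ρ ^ (d + 1))) * R' / R) * trIP (fun _ => (1 : ℝ)) Ψ Ψ ≤
        trIP (fun _ => (1 : ℝ)) Ψ (deltaAY i parS parB Gp (prodCfg U₀ η a) Ψ) :=
  trIP_deltaAY_prodCfg_ge_of_coer_centre i parS parB Gp U₀ η hA hρ (card_fibre_bondReadingY_matrixUnits i hNf) hco hR' hR'R

/-- ★ **83 §4 LOCATED — THEOREM 3.11's CLAUSE ON THE LOCATED BALL AROUND A COERCIVE BACKGROUND, AT THE BOND READING OF RECORD**: the same inputs with `0 < m` and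
`2(B_Δ((d+1)N²c₀(1,ρ)^{d+1}))R′ < mR` ⟹ `PosDefTr 1 (Δ_a(e^{iηA′}U₀))` for every `‖A′‖ < R′`.
[cite: Balaban1985BackgroundPropagators, Thm 3.4 p.400, (3.62)–(3.64) p.402, Thm 3.10 (3.108) p.416, Thm 3.11 p.416; Balaban1988RG2Cluster, p.15] -/
theorem posDefTr_deltaAY_prodCfg_of_coer_centre_located (parS : SiteParY (Matrix (Fin N) (Fin N) ℂ) i)
    (parB : BondParY (Matrix (Fin N) (Fin N) ℂ) i) (Gp : SiteOpY (Matrix (Fin N) (Fin N) ℂ) i) (U₀ : CfgY (Matrix (Fin N) (Fin N) ℂ) i)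
    (hNf : ∀ μ, (toKT i).NB μ = Nf μ) (η : ℝ) {R R' ρ BΔ m : ℝ}
    (hA : RawEntryLetters (fun a : Fin (d + 1) → Site (PV d ℓ i.m i.K hd hL) 0 → Matrix (Fin N) (Fin N) ℂ =>
      LinearMap.toMatrix
        ((Pi.basis fun _ : FBondY i => Matrix.stdBasis ℂ (Fin N) (Fin N)).reindex (Equiv.sigmaEquivProd (FBondY i) (Fin N × Fin N)))
        ((Pi.basis fun _ : FBondY i => Matrix.stdBasis ℂ (Fin N) (Fin N)).reindex (Equiv.sigmaEquivProd (FBondY i) (Fin N × Fin N)))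
        (deltaAY i parS parB Gp (prodCfg U₀ η a)))
      (fun p : FBondY i × (Fin N × Fin N) => bondReadingY i hNf p.1) R ρ BΔ)
    (hρ : 0 < ρ) (hm : 0 < m)
    (hco : ∀ Ψ : FBondY i → Matrix (Fin N) (Fin N) ℂ, m * trIP (fun _ => (1 : ℝ)) Ψ Ψ ≤ trIP (fun _ => (1 : ℝ)) Ψ (deltaAY i parS parB Gp U₀ Ψ))
    (hR' : 0 ≤ R') (hR'R : R' ≤ R) (hsmall : 2 * (BΔ * ((((d + 1) * (N * N) : ℕ) : ℝ) * B6.c0 1 ρ ^ (d + 1))) * R' < m * R) :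
    ∀ a ∈ ball (0 : Fin (d + 1) → Site (PV d ℓ i.m i.K hd hL) 0 → Matrix (Fin N) (Fin N) ℂ) R',
      PosDefTr (fun _ => (1 : ℝ)) (deltaAY i parS parB Gp (prodCfg U₀ η a)) :=
  posDefTr_deltaAY_prodCfg_of_coer_centre i parS parB Gp U₀ η hA hρ (card_fibre_bondReadingY_matrixUnits i hNf) hm hco hR' hR'R hsmall

/-- ★ **83 §4 LOCATED — … AND ON THE GAUGE ORBIT OF THAT BALL** (v4 letters `parSymY ∕ parBY ∕ G′ = GpY parSymY`): for every unitary-valued gauge transformation `u` and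
every `‖A′‖ < R′` in the located ball, `PosDefTr 1 (Δ_a((e^{iηA′}U₀)^u))` — (3.34) through n06-j's `posDefTr_deltaAY_parSymY_gaugeY_iff`, bond reading of record.
[cite: Balaban1985BackgroundPropagators, (3.34) p.396, Thm 3.4 p.400, Thm 3.11 p.416; Balaban1988RG2Cluster, p.15] -/
theorem posDefTr_deltaAY_parSymY_gaugeY_prodCfg_of_coer_centre_located (U₀ : CfgY (Matrix (Fin N) (Fin N) ℂ) i)
    (hNf : ∀ μ, (toKT i).NB μ = Nf μ) (η : ℝ) {R R' ρ BΔ m : ℝ}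
    (hA : RawEntryLetters (fun a : Fin (d + 1) → Site (PV d ℓ i.m i.K hd hL) 0 → Matrix (Fin N) (Fin N) ℂ =>
      LinearMap.toMatrix
        ((Pi.basis fun _ : FBondY i => Matrix.stdBasis ℂ (Fin N) (Fin N)).reindex (Equiv.sigmaEquivProd (FBondY i) (Fin N × Fin N)))
        ((Pi.basis fun _ : FBondY i => Matrix.stdBasis ℂ (Fin N) (Fin N)).reindex (Equiv.sigmaEquivProd (FBondY i) (Fin N × Fin N)))
        (deltaAY i (parSymY i) (parBY i) (GpY i (parSymY i)) (prodCfg U₀ η a)))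
      (fun p : FBondY i × (Fin N × Fin N) => bondReadingY i hNf p.1) R ρ BΔ)
    (hρ : 0 < ρ) (hm : 0 < m)
    (hco : ∀ Ψ : FBondY i → Matrix (Fin N) (Fin N) ℂ, m * trIP (fun _ => (1 : ℝ)) Ψ Ψ ≤ trIP (fun _ => (1 : ℝ)) Ψ (deltaAY i (parSymY i) (parBY i) (GpY i (parSymY i)) U₀ Ψ))
    (hR' : 0 ≤ R') (hR'R : R' ≤ R) (hsmall : 2 * (BΔ * ((((d + 1) * (N * N) : ℕ) : ℝ) * B6.c0 1 ρ ^ (d + 1))) * R' < m * R)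
    {u : GaugeY (Matrix (Fin N) (Fin N) ℂ) i} (hu : ∀ x, ((u x : (Matrix (Fin N) (Fin N) ℂ)ˣ) : Matrix (Fin N) (Fin N) ℂ) ∈ unitary _) :
    ∀ a ∈ ball (0 : Fin (d + 1) → Site (PV d ℓ i.m i.K hd hL) 0 → Matrix (Fin N) (Fin N) ℂ) R',
      PosDefTr (fun _ => (1 : ℝ)) (deltaAY i (parSymY i) (parBY i) (GpY i (parSymY i)) (gaugeY i u (prodCfg U₀ η a))) :=
  posDefTr_deltaAY_parSymY_gaugeY_prodCfg_of_coer_centre i U₀ η hA hρ (card_fibre_bondReadingY_matrixUnits i hNf) hm hco hR' hR'R hsmall hu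

/-- ★ **83 §4 LOCATED — … FROM PRINT's TWO STATEMENTS AT THE CENTRE** (v4 letters, `G ≤ U(N)`, `G`-valued `U₀`): Theorem 3.11's clause `PosDefTr 1 (Δ_a(U₀))` + Theorem
3.3's (3.46)–(3.47) form bound `⟨Φ, G(U₀)Φ⟩₁ ≤ B⟨Φ,Φ⟩₁` (`0 < B`; module 82: `m = B⁻¹`), Δ_a's pencil letters at the bond reading, `0 ≤ R′ ≤ R`,
`2(B_Δ((d+1)N²c₀(1,ρ)^{d+1}))R′ < B⁻¹R` ⟹ `PosDefTr 1 (Δ_a(e^{iηA′}U₀))` for every `‖A′‖ < R′`.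
[cite: Balaban1985BackgroundPropagators, (3.26)–(3.27) p.395, (3.46)–(3.47) p.398, Thm 3.3 p.399, Thm 3.4 p.400, Thm 3.11 p.416; Balaban1984PropagatorsII, p.226; Balaban1988RG2Cluster, p.15] -/
theorem posDefTr_deltaAY_parSymY_prodCfg_of_posDefTr_of_GAY_formBound_located
    (hG : G ≤ B7Prop2Explicit.unitaryUnits (Matrix (Fin N) (Fin N) ℂ))
    {U₀ : CfgY (Matrix (Fin N) (Fin N) ℂ) i} (hU : ∀ μ x, U₀ μ x ∈ G) (hNf : ∀ μ, (toKT i).NB μ = Nf μ) (η : ℝ) {R R' ρ BΔ : ℝ}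
    (hA : RawEntryLetters (fun a : Fin (d + 1) → Site (PV d ℓ i.m i.K hd hL) 0 → Matrix (Fin N) (Fin N) ℂ =>
      LinearMap.toMatrix
        ((Pi.basis fun _ : FBondY i => Matrix.stdBasis ℂ (Fin N) (Fin N)).reindex (Equiv.sigmaEquivProd (FBondY i) (Fin N × Fin N)))
        ((Pi.basis fun _ : FBondY i => Matrix.stdBasis ℂ (Fin N) (Fin N)).reindex (Equiv.sigmaEquivProd (FBondY i) (Fin N × Fin N)))
        (deltaAY i (parSymY i) (parBY i) (GpY i (parSymY i)) (prodCfg U₀ η a)))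
      (fun p : FBondY i × (Fin N × Fin N) => bondReadingY i hNf p.1) R ρ BΔ)
    (hρ : 0 < ρ)
    -- print's two statements at the centre: Theorem 3.11's clause (row 17) and Theorem 3.3's (3.46)–(3.47) for `G`
    (hpd : PosDefTr (fun _ => (1 : ℝ)) (deltaAY i (parSymY i) (parBY i) (GpY i (parSymY i)) U₀))
    {B : ℝ} (hB : 0 < B)
    (hGB : ∀ Φ : FBondY i → Matrix (Fin N) (Fin N) ℂ,
      trIP (fun _ => (1 : ℝ)) Φ (GAY i (parSymY i) (parBY i) (GpY i (parSymY i)) U₀ Φ) ≤ B * trIP (fun _ => (1 : ℝ)) Φ Φ)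
    (hR' : 0 ≤ R') (hR'R : R' ≤ R) (hsmall : 2 * (BΔ * ((((d + 1) * (N * N) : ℕ) : ℝ) * B6.c0 1 ρ ^ (d + 1))) * R' < B⁻¹ * R) :
    ∀ a ∈ ball (0 : Fin (d + 1) → Site (PV d ℓ i.m i.K hd hL) 0 → Matrix (Fin N) (Fin N) ℂ) R',
      PosDefTr (fun _ => (1 : ℝ)) (deltaAY i (parSymY i) (parBY i) (GpY i (parSymY i)) (prodCfg U₀ η a)) :=
  posDefTr_deltaAY_parSymY_prodCfg_of_posDefTr_of_GAY_formBound i hG hU η hA hρ (card_fibre_bondReadingY_matrixUnits i hNf) hpd hB hGB hR' hR'R hsmall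

end Displayed

/-! ## §2. Δ_a's pencil letters DISCHARGED from the R-station's output `hR` (`parB := parBY`, `G ≤ U(N)`, `G`-valued `U₀`, `N ≥ 1`): the clause's ball from `hR`, `B′`, `m` -/

section Discharged

variable [NeZero N]
variable (parS : SiteParY (Matrix (Fin N) (Fin N) ℂ) i) (Gp : SiteOpY (Matrix (Fin N) (Fin N) ℂ) i)

/-- ★★ **COERCIVITY OF `Δ_a` ON THE BALL FROM THE R-STATION's OUTPUT** (ANY `parS Gp`, `parB := parBY`, `G ≤ U(N)`, `G`-valued `U₀`): the R-station's output `hR` at the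
fine reading (radius `Rd`, rate `ρ > 0`, constant `B_R`), ONE dominating constant `B′` for the assembled Δ_a letters (`hBΔ`, its left side the NUMBER of
`B13InverseLettersOnCoerciveBallLocated.rawEntryLetters_toMatrix_deltaAY_parBY_prodCfg_of_pencil_located`), the centre's flat coercivity `m`, radii `0 ≤ R′ ≤ Rd` ⟹ for every
`‖A′‖ < R′` and every `Ψ`: `(m − 2(B′((d+1)N²c₀(1,ρ)^{d+1}))R′∕Rd)·⟨Ψ,Ψ⟩₁ ≤ ⟨Ψ, Δ_a(e^{iηA′}U₀)Ψ⟩₁`.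
[cite: Balaban1985BackgroundPropagators, (3.10) p.392, (3.25)–(3.27) pp.394–395, Thm 3.4 and (3.50) p.400, (3.62)–(3.64) p.402, (3.84) p.407, Thm 3.10 (3.107)–(3.108) p.416, Thm 3.11 p.416; Balaban1988RG2Cluster, (2.5)–(2.7) pp.12–13, p.15; Balaban1984PropagatorsII, (2.54) p.232, Lemma 2.1 (2.61) p.234] -/
theorem trIP_deltaAY_parBY_prodCfg_ge_of_pencil_of_coer_centre_located
    (hG : G ≤ B7Prop2Explicit.unitaryUnits (Matrix (Fin N) (Fin N) ℂ))
    {U₀ : CfgY (Matrix (Fin N) (Fin N) ℂ) i} (hU₀ : ∀ μ x, U₀ μ x ∈ G)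
    (hNf : ∀ μ, (toKT i).NB μ = Nf μ) (η : ℝ) {Rd : ℝ} (hRd : 0 ≤ Rd) {ρ BR : ℝ} (hρ : 0 < ρ)
    (hR : RawEntryLetters (fun a : Fin (d + 1) → Site (PV d ℓ i.m i.K hd hL) 0 → Matrix (Fin N) (Fin N) ℂ =>
      LinearMap.toMatrix
        ((Pi.basis fun _ : SiteY i => Matrix.stdBasis ℂ (Fin N) (Fin N)).reindex (Equiv.sigmaEquivProd (SiteY i) (Fin N × Fin N)))
        ((Pi.basis fun _ : SiteY i => Matrix.stdBasis ℂ (Fin N) (Fin N)).reindex (Equiv.sigmaEquivProd (SiteY i) (Fin N × Fin N)))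
        (RY i parS Gp (prodCfg U₀ η a)))
      (fun q : SiteY i × (Fin N × Fin N) => fineReadingY i hNf q.1) Rd ρ BR)
    {B' : ℝ}
    (hBΔ : 1 * (((4 * ((d : ℝ) + 1) * |i.cf|) * ((1 * Real.exp (|η| * Rd)) * ((1 * Real.exp (|η| * Rd)) ^ 4 * ((4 * |i.cf|) * ((1 * Real.exp (|η| * Rd)) * 1 * (1 * Real.exp (|η| * Rd))))) * (1 * Real.exp (|η| * Rd))) + 1 / 2 * ((4 * ((d : ℝ) + 1)) * ((1 * Real.exp (|η| * Rd)) * (2 * (i.cf ^ 2 * (1 * Real.exp (|η| * Rd)) ^ 4) * (8 * ((1 * Real.exp (|η| * Rd)) * 1 * (1 * Real.exp (|η| * Rd))))) * (1 * Real.exp (|η| * Rd))))) + 2 * ((1 * Real.exp (|η| * Rd)) ^ ((d + 2) * ((ℓ + 1) ^ i.k - 1)) * ((|b₁| * i.cf ^ 2 * ((((ℓ + 1 : ℕ) : ℝ)) ^ i.k) ^ (d + 1)) * (1 * ((1 * Real.exp (|η| * Rd)) ^ ((d + 2) * ((ℓ + 1) ^ i.k - 1)) * 1 * (1 * Real.exp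 (|η| * Rd)) ^ ((d + 2) * ((ℓ + 1) ^ i.k - 1))))) * (1 * Real.exp (|η| * Rd)) ^ ((d + 2) * ((ℓ + 1) ^ i.k - 1)))) * Real.exp (ρ * (2 * (((d : ℝ) + 2) * ((((ℓ + 1) ^ i.k : ℕ) : ℝ) - 1)))) +
          (2 * |i.cf|) * (Fintype.card (Fin N × Fin N) : ℝ) * (1 * ((1 * Real.exp (|η| * Rd)) * 1 * (1 * Real.exp (|η| * Rd)))) * ((2 * |i.cf|) * (Fintype.card (Fin N × Fin N) : ℝ) * (1 * ((1 * Real.exp (|η| * Rd)) * 1 * (1 * Real.exp (|η| * Rd))))) * BR * Real.exp (2 * ρ * 1) ≤ B')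
    {m : ℝ}
    (hco : ∀ Ψ : FBondY i → Matrix (Fin N) (Fin N) ℂ, m * trIP (fun _ => (1 : ℝ)) Ψ Ψ ≤ trIP (fun _ => (1 : ℝ)) Ψ (deltaAY i parS (parBY i) Gp U₀ Ψ))
    {R' : ℝ} (hR' : 0 ≤ R') (hR'R : R' ≤ Rd) :
    ∀ a ∈ ball (0 : Fin (d + 1) → Site (PV d ℓ i.m i.K hd hL) 0 → Matrix (Fin N) (Fin N) ℂ) R', ∀ Ψ : FBondY i → Matrix (Fin N) (Fin N) ℂ,
      (m - 2 * (B' * ((((d + 1) * (N * N) : ℕ) : ℝ) * B6.c0 1 ρ ^ (d + 1))) * R' / Rd) * trIP (fun _ => (1 : ℝ)) Ψ Ψ ≤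
        trIP (fun _ => (1 : ℝ)) Ψ (deltaAY i parS (parBY i) Gp (prodCfg U₀ η a) Ψ) := by
  have hA := rawEntryLetters_toMatrix_deltaAY_parBY_prodCfg_of_pencil_located i parS Gp hG hU₀ hNf η hRd hρ.le hR
  exact trIP_deltaAY_prodCfg_ge_of_coer_centre_located i parS (parBY i) Gp U₀ hNf η (rawEntryLetters_mono hA le_rfl le_rfl hBΔ) hρ hco hR' hR'R

/-- ★★ **THEOREM 3.11's CLAUSE ON THE LOCATED BALL FROM THE R-STATION's OUTPUT**: the same inputs with `0 < m` and `2(B′((d+1)N²c₀(1,ρ)^{d+1}))R′ < mRd` ⟹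
`PosDefTr 1 (Δ_a(e^{iηA′}U₀))` for every `‖A′‖ < R′` — the N06 certificate's row-17 clause on an OPEN located ball around any coercive background, the ball's
radius a NUMBER in `(m, B′, d, N, ρ, Rd)`.
[cite: Balaban1985BackgroundPropagators, (3.10) p.392, (3.25)–(3.27) pp.394–395, Thm 3.4 and (3.50) p.400, (3.62)–(3.64) p.402, (3.84) p.407, Thm 3.10 (3.107)–(3.108) p.416, Thm 3.11 p.416; Balaban1988RG2Cluster, (2.5)–(2.7) pp.12–13, p.15; Balaban1984PropagatorsII, (2.54) p.232, Lemma 2.1 (2.61) p.234] -/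
theorem posDefTr_deltaAY_parBY_prodCfg_of_pencil_of_coer_centre_located
    (hG : G ≤ B7Prop2Explicit.unitaryUnits (Matrix (Fin N) (Fin N) ℂ))
    {U₀ : CfgY (Matrix (Fin N) (Fin N) ℂ) i} (hU₀ : ∀ μ x, U₀ μ x ∈ G)
    (hNf : ∀ μ, (toKT i).NB μ = Nf μ) (η : ℝ) {Rd : ℝ} (hRd : 0 ≤ Rd) {ρ BR : ℝ} (hρ : 0 < ρ)
    (hR : RawEntryLetters (fun a : Fin (d + 1) → Site (PV d ℓ i.m i.K hd hL) 0 → Matrix (Fin N) (Fin N) ℂ =>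
      LinearMap.toMatrix
        ((Pi.basis fun _ : SiteY i => Matrix.stdBasis ℂ (Fin N) (Fin N)).reindex (Equiv.sigmaEquivProd (SiteY i) (Fin N × Fin N)))
        ((Pi.basis fun _ : SiteY i => Matrix.stdBasis ℂ (Fin N) (Fin N)).reindex (Equiv.sigmaEquivProd (SiteY i) (Fin N × Fin N)))
        (RY i parS Gp (prodCfg U₀ η a)))
      (fun q : SiteY i × (Fin N × Fin N) => fineReadingY i hNf q.1) Rd ρ BR)
    {B' : ℝ}
    (hBΔ : 1 * (((4 * ((d : ℝ) + 1) * |i.cf|) * ((1 * Real.exp (|η| * Rd)) * ((1 * Real.exp (|η| * Rd)) ^ 4 * ((4 * |i.cf|) * ((1 * Real.exp (|η| * Rd)) * 1 * (1 * Real.exp (|η| * Rd))))) * (1 * Real.exp (|η| * Rd))) + 1 / 2 * ((4 * ((d : ℝ) + 1)) * ((1 * Real.exp (|η| * Rd)) * (2 * (i.cf ^ 2 * (1 * Real.exp (|η| * Rd)) ^ 4) * (8 * ((1 * Real.exp (|η| * Rd)) * 1 * (1 * Real.exp (|η| * Rd))))) * (1 * Real.exp (|η| * Rd))))) + 2 *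 ((1 * Real.exp (|η| * Rd)) ^ ((d + 2) * ((ℓ + 1) ^ i.k - 1)) * ((|b₁| * i.cf ^ 2 * ((((ℓ + 1 : ℕ) : ℝ)) ^ i.k) ^ (d + 1)) * (1 * ((1 * Real.exp (|η| * Rd)) ^ ((d + 2) * ((ℓ + 1) ^ i.k - 1)) * 1 * (1 * Real.exp (|η| * Rd)) ^ ((d + 2) * ((ℓ + 1) ^ i.k - 1))))) * (1 * Real.exp (|η| * Rd)) ^ ((d + 2) * ((ℓ + 1) ^ i.k - 1)))) * Real.exp (ρ * (2 * (((d : ℝ) + 2) * ((((ℓ + 1) ^ i.k : ℕ) : ℝ) - 1)))) +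
          (2 * |i.cf|) * (Fintype.card (Fin N × Fin N) : ℝ) * (1 * ((1 * Real.exp (|η| * Rd)) * 1 * (1 * Real.exp (|η| * Rd)))) * ((2 * |i.cf|) * (Fintype.card (Fin N × Fin N) : ℝ) * (1 * ((1 * Real.exp (|η| * Rd)) * 1 * (1 * Real.exp (|η| * Rd))))) * BR * Real.exp (2 * ρ * 1) ≤ B')
    {m : ℝ} (hm : 0 < m)
    (hco : ∀ Ψ : FBondY i → Matrix (Fin N) (Fin N) ℂ, m * trIP (fun _ => (1 : ℝ)) Ψ Ψ ≤ trIP (fun _ => (1 : ℝ)) Ψ (deltaAY i parS (parBY i) Gp U₀ Ψ))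
    {R' : ℝ} (hR' : 0 ≤ R') (hR'R : R' ≤ Rd) (hsmall : 2 * (B' * ((((d + 1) * (N * N) : ℕ) : ℝ) * B6.c0 1 ρ ^ (d + 1))) * R' < m * Rd) :
    ∀ a ∈ ball (0 : Fin (d + 1) → Site (PV d ℓ i.m i.K hd hL) 0 → Matrix (Fin N) (Fin N) ℂ) R',
      PosDefTr (fun _ => (1 : ℝ)) (deltaAY i parS (parBY i) Gp (prodCfg U₀ η a)) := by
  have hA := rawEntryLetters_toMatrix_deltaAY_parBY_prodCfg_of_pencil_located i parS Gp hG hU₀ hNf η hRd hρ.le hR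
  exact posDefTr_deltaAY_prodCfg_of_coer_centre_located i parS (parBY i) Gp U₀ hNf η (rawEntryLetters_mono hA le_rfl le_rfl hBΔ) hρ hm hco hR' hR'R hsmall

/-- ★★ **… AND ON THE GAUGE ORBIT OF THAT BALL** (v4 letters): for every unitary-valued gauge transformation `u` and every `‖A′‖ < R′` in the located ball from `hR`,
`PosDefTr 1 (Δ_a((e^{iηA′}U₀)^u))` — an OPEN GAUGE-INVARIANT inhabitant class of row 17 around the orbit of any coercive background, radius from the R-station's output.
[cite: Balaban1985BackgroundPropagators, (3.10) p.392, (3.25)–(3.27) pp.394–395, (3.34) p.396, Thm 3.4 and (3.50) p.400, (3.62)–(3.64) p.402, Thm 3.10 (3.107)–(3.108) p.416, Thm 3.11 p.416; Balaban1988RG2Cluster, (2.5)–(2.7) pp.12–13, p.15] -/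
theorem posDefTr_deltaAY_parSymY_gaugeY_prodCfg_of_pencil_of_coer_centre_located
    (hG : G ≤ B7Prop2Explicit.unitaryUnits (Matrix (Fin N) (Fin N) ℂ))
    {U₀ : CfgY (Matrix (Fin N) (Fin N) ℂ) i} (hU₀ : ∀ μ x, U₀ μ x ∈ G)
    (hNf : ∀ μ, (toKT i).NB μ = Nf μ) (η : ℝ) {Rd : ℝ} (hRd : 0 ≤ Rd) {ρ BR : ℝ} (hρ : 0 < ρ)
    (hR : RawEntryLetters (fun a : Fin (d + 1) → Site (PV d ℓ i.m i.K hd hL) 0 → Matrix (Fin N) (Fin N) ℂ =>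
      LinearMap.toMatrix
        ((Pi.basis fun _ : SiteY i => Matrix.stdBasis ℂ (Fin N) (Fin N)).reindex (Equiv.sigmaEquivProd (SiteY i) (Fin N × Fin N)))
        ((Pi.basis fun _ : SiteY i => Matrix.stdBasis ℂ (Fin N) (Fin N)).reindex (Equiv.sigmaEquivProd (SiteY i) (Fin N × Fin N)))
        (RY i (parSymY i) (GpY i (parSymY i)) (prodCfg U₀ η a)))
      (fun q : SiteY i × (Fin N × Fin N) => fineReadingY i hNf q.1) Rd ρ BR)
    {B' : ℝ}
    (hBΔ : 1 * (((4 * ((d : ℝ) + 1) * |i.cf|) * ((1 * Real.exp (|η| * Rd)) * ((1 * Real.exp (|η| * Rd)) ^ 4 * ((4 * |i.cf|) * ((1 * Real.exp (|η| * Rd)) * 1 * (1 * Real.exp (|η| * Rd))))) * (1 * Real.exp (|η| * Rd))) + 1 / 2 * ((4 * ((d : ℝ) + 1)) * ((1 * Real.exp (|η| * Rd)) * (2 * (i.cf ^ 2 * (1 * Real.exp (|η| * Rd)) ^ 4) * (8 * ((1 * Real.exp (|η| * Rd)) * 1 * (1 * Real.exp (|η| * Rd))))) * (1 * Real.exp (|η|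 * Rd))))) + 2 * ((1 * Real.exp (|η| * Rd)) ^ ((d + 2) * ((ℓ + 1) ^ i.k - 1)) * ((|b₁| * i.cf ^ 2 * ((((ℓ + 1 : ℕ) : ℝ)) ^ i.k) ^ (d + 1)) * (1 * ((1 * Real.exp (|η| * Rd)) ^ ((d + 2) * ((ℓ + 1) ^ i.k - 1)) * 1 * (1 * Real.exp (|η| * Rd)) ^ ((d + 2) * ((ℓ + 1) ^ i.k - 1))))) * (1 * Real.exp (|η| * Rd)) ^ ((d + 2) * ((ℓ + 1) ^ i.k - 1)))) * Real.exp (ρ * (2 * (((d : ℝ) + 2) * ((((ℓ + 1) ^ i.k : ℕ) : ℝ) - 1)))) +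
          (2 * |i.cf|) * (Fintype.card (Fin N × Fin N) : ℝ) * (1 * ((1 * Real.exp (|η| * Rd)) * 1 * (1 * Real.exp (|η| * Rd)))) * ((2 * |i.cf|) * (Fintype.card (Fin N × Fin N) : ℝ) * (1 * ((1 * Real.exp (|η| * Rd)) * 1 * (1 * Real.exp (|η| * Rd))))) * BR * Real.exp (2 * ρ * 1) ≤ B')
    {m : ℝ} (hm : 0 < m)
    (hco : ∀ Ψ : FBondY i → Matrix (Fin N) (Fin N) ℂ, m * trIP (fun _ => (1 : ℝ)) Ψ Ψ ≤ trIP (fun _ => (1 : ℝ)) Ψ (deltaAY i (parSymY i) (parBY i) (GpY i (parSymY i)) U₀ Ψ))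
    {R' : ℝ} (hR' : 0 ≤ R') (hR'R : R' ≤ Rd) (hsmall : 2 * (B' * ((((d + 1) * (N * N) : ℕ) : ℝ) * B6.c0 1 ρ ^ (d + 1))) * R' < m * Rd)
    {u : GaugeY (Matrix (Fin N) (Fin N) ℂ) i} (hu : ∀ x, ((u x : (Matrix (Fin N) (Fin N) ℂ)ˣ) : Matrix (Fin N) (Fin N) ℂ) ∈ unitary _) :
    ∀ a ∈ ball (0 : Fin (d + 1) → Site (PV d ℓ i.m i.K hd hL) 0 → Matrix (Fin N) (Fin N) ℂ) R',
      PosDefTr (fun _ => (1 : ℝ)) (deltaAY i (parSymY i) (parBY i) (GpY i (parSymY i)) (gaugeY i u (prodCfg U₀ η a))) := by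
  have hA := rawEntryLetters_toMatrix_deltaAY_parBY_prodCfg_of_pencil_located i (parSymY i) (GpY i (parSymY i)) hG hU₀ hNf η hRd hρ.le hR
  exact posDefTr_deltaAY_parSymY_gaugeY_prodCfg_of_coer_centre_located i U₀ hNf η (rawEntryLetters_mono hA le_rfl le_rfl hBΔ) hρ hm hco hR' hR'R hsmall hu

/-- ★★ **… FROM PRINT's TWO STATEMENTS AT THE CENTRE** (v4 letters, `G ≤ U(N)`, `G`-valued `U₀`): `hR`, `hBΔ`, Theorem 3.11's clause `hpd` and Theorem 3.3's (3.46)–(3.47)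
form bound `hGB` (`0 < B`; module 82: `m = B⁻¹`), `0 ≤ R′ ≤ Rd`, `2(B′((d+1)N²c₀(1,ρ)^{d+1}))R′ < B⁻¹Rd` ⟹ `PosDefTr 1 (Δ_a(e^{iηA′}U₀))` for every `‖A′‖ < R′` —
print's two statements AT ONE BACKGROUND give the clause on the whole located chart ball around it, the radius a NUMBER.
[cite: Balaban1985BackgroundPropagators, (3.10) p.392, (3.25)–(3.27) pp.394–395, (3.46)–(3.47) p.398, Thm 3.3 p.399, Thm 3.4 and (3.50) p.400, (3.62)–(3.64) p.402, Thm 3.10 (3.107)–(3.108) p.416, Thm 3.11 p.416; Balaban1984PropagatorsII, p.226; Balaban1988RG2Cluster, (2.5)–(2.7) pp.12–13, p.15] -/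
theorem posDefTr_deltaAY_parSymY_prodCfg_of_pencil_of_posDefTr_of_GAY_formBound_located
    (hG : G ≤ B7Prop2Explicit.unitaryUnits (Matrix (Fin N) (Fin N) ℂ))
    {U₀ : CfgY (Matrix (Fin N) (Fin N) ℂ) i} (hU₀ : ∀ μ x, U₀ μ x ∈ G)
    (hNf : ∀ μ, (toKT i).NB μ = Nf μ) (η : ℝ) {Rd : ℝ} (hRd : 0 ≤ Rd) {ρ BR : ℝ} (hρ : 0 < ρ)
    (hR : RawEntryLetters (fun a : Fin (d + 1) → Site (PV d ℓ i.m i.K hd hL) 0 → Matrix (Fin N) (Fin N) ℂ =>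
      LinearMap.toMatrix
        ((Pi.basis fun _ : SiteY i => Matrix.stdBasis ℂ (Fin N) (Fin N)).reindex (Equiv.sigmaEquivProd (SiteY i) (Fin N × Fin N)))
        ((Pi.basis fun _ : SiteY i => Matrix.stdBasis ℂ (Fin N) (Fin N)).reindex (Equiv.sigmaEquivProd (SiteY i) (Fin N × Fin N)))
        (RY i (parSymY i) (GpY i (parSymY i)) (prodCfg U₀ η a)))
      (fun q : SiteY i × (Fin N × Fin N) => fineReadingY i hNf q.1) Rd ρ BR)
    {B' : ℝ}
    (hBΔ : 1 * (((4 * ((d : ℝ) + 1) * |i.cf|) * ((1 * Real.exp (|η| * Rd)) * ((1 * Real.exp (|η| * Rd)) ^ 4 * ((4 * |i.cf|) * ((1 * Real.exp (|η| * Rd)) * 1 * (1 * Real.exp (|η| * Rd))))) * (1 * Real.exp (|η| * Rd))) + 1 / 2 * ((4 * ((d : ℝ) + 1)) * ((1 * Real.exp (|η| * Rd)) * (2 * (i.cf ^ 2 * (1 * Real.exp (|η| * Rd)) ^ 4) * (8 * ((1 * Real.exp (|η| * Rd)) * 1 * (1 * Real.exp (|η| * Rd))))) * (1 * Real.exp (|η|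 * Rd))))) + 2 * ((1 * Real.exp (|η| * Rd)) ^ ((d + 2) * ((ℓ + 1) ^ i.k - 1)) * ((|b₁| * i.cf ^ 2 * ((((ℓ + 1 : ℕ) : ℝ)) ^ i.k) ^ (d + 1)) * (1 * ((1 * Real.exp (|η| * Rd)) ^ ((d + 2) * ((ℓ + 1) ^ i.k - 1)) * 1 * (1 * Real.exp (|η| * Rd)) ^ ((d + 2) * ((ℓ + 1) ^ i.k - 1))))) * (1 * Real.exp (|η| * Rd)) ^ ((d + 2) * ((ℓ + 1) ^ i.k - 1)))) * Real.exp (ρ * (2 * (((d : ℝ) + 2) * ((((ℓ + 1) ^ i.k : ℕ) : ℝ) - 1)))) +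
          (2 * |i.cf|) * (Fintype.card (Fin N × Fin N) : ℝ) * (1 * ((1 * Real.exp (|η| * Rd)) * 1 * (1 * Real.exp (|η| * Rd)))) * ((2 * |i.cf|) * (Fintype.card (Fin N × Fin N) : ℝ) * (1 * ((1 * Real.exp (|η| * Rd)) * 1 * (1 * Real.exp (|η| * Rd))))) * BR * Real.exp (2 * ρ * 1) ≤ B')
    -- print's two statements at the centre: Theorem 3.11's clause (row 17) and Theorem 3.3's (3.46)–(3.47) for `G`
    (hpd : PosDefTr (fun _ => (1 : ℝ)) (deltaAY i (parSymY i) (parBY i) (GpY i (parSymY i)) U₀))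
    {B : ℝ} (hB : 0 < B)
    (hGB : ∀ Φ : FBondY i → Matrix (Fin N) (Fin N) ℂ,
      trIP (fun _ => (1 : ℝ)) Φ (GAY i (parSymY i) (parBY i) (GpY i (parSymY i)) U₀ Φ) ≤ B * trIP (fun _ => (1 : ℝ)) Φ Φ)
    {R' : ℝ} (hR' : 0 ≤ R') (hR'R : R' ≤ Rd) (hsmall : 2 * (B' * ((((d + 1) * (N * N) : ℕ) : ℝ) * B6.c0 1 ρ ^ (d + 1))) * R' < B⁻¹ * Rd) :
    ∀ a ∈ ball (0 : Fin (d + 1) → Site (PV d ℓ i.m i.K hd hL) 0 → Matrix (Fin N) (Fin N) ℂ) R',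
      PosDefTr (fun _ => (1 : ℝ)) (deltaAY i (parSymY i) (parBY i) (GpY i (parSymY i)) (prodCfg U₀ η a)) :=
  posDefTr_deltaAY_parBY_prodCfg_of_pencil_of_coer_centre_located i (parSymY i) (GpY i (parSymY i)) hG hU₀ hNf η hRd hρ hR hBΔ (inv_pos.mpr hB)
    (trIP_deltaAY_parSymY_ge_of_posDefTr_of_GAY_formBound i hG hU₀ hpd hB hGB) hR' hR'R hsmall

end Discharged

end Literature.MathematicalPhysics.QuantumFieldTheory.Balaban1983to89.B13CoerciveAlongPencilLocated

end
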